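import Summits.NavierStokesRegularity.NavierStokesRegularity.Theorems.SwirlFreeBudget
import Literature.Analysis.FunctionSpaces.MoserIteration
import HarnessLib

/-!
# SwirlFreeBudget, toward crux K-18.1 `EtaMoserBound` (T-18.2): Moser's chain on nested parabolic
# cylinders — from the reverse Hölder step (memo A.5) to the `L² → L^∞` bound (memo A.6), generic
# (seat nsreg-p4 g12)

Support file for the DORMANT route `SwirlThreshold` (crux stmt-NavierStokesRegularity-2002) and
planner nsreg-p2's ROUND-18 Appendix A (`R18-APPENDIX-EtaMoser.md`).  Step A.5 ⇒ A.6 there is the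
standard Moser bookkeeping: the reverse Hölder inequalities
`‖g‖_{L^{10m/3}(Q(z₁,ϱ))} ≤ (N₀ ϱ'/(ϱ'-ϱ)²)^{1/m} ‖g‖_{L^{2m}(Q(z₁,ϱ'))}` (`m ≥ 1`,
`ρ ≤ ϱ < ϱ' ≤ ρ'`, `ρ'/2 ≤ ρ`) iterated along `μ_j = ρ + 2^{-j}(ρ' - ρ)`, `m_j = (5/3)^j`, give
`‖g‖_{L^∞(Q(z₁,ρ))} ≤ (16 N₀² ρ'²)^{5/4} 16^{15/8} (ρ'-ρ)^{-5} ‖g‖_{L²(Q(z₁,ρ'))}`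
(`∑ (3/5)^j = 5/2`, exponents `5/4 = χ/(p₀(χ-1))`, `15/8 = χ/(p₀(χ-1)²)` for `p₀ = 2`, `χ = 5/3`).
This file proves exactly that for an ARBITRARY a.e.-strongly measurable `g` on parabolic
cylinders (`eLpNorm_top_le_of_reverseHolder_parabolicCylinder`), by instantiating the tree's
abstract iteration `Literature.Analysis.FunctionSpaces.eLpNorm_top_le_of_moser_chain`.

WHAT THIS IS NOT: not NS regularity — measure-theoretic bookkeeping (one brick of the η-Moser
iteration; the reverse Hölder step for `η = ω_θ/r` and `EtaMoserBound` itself stay OPEN); no crux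
claim.
-/

namespace Summit.NavierStokesRegularity.NavierStokesRegularity.Theorems.SwirlFreeBudget

open MeasureTheory Set Filter Topology Metric Function
open scoped ENNReal NNReal
open Literature.Analysis Literature.Analysis.FluidPDE Literature.Analysis.FunctionSpaces

noncomputable section

/-- The dyadic radii `μ_j = ρ + 2^{-j}(ρ' - ρ)` of Moser's chain. -/
theorem moserRadius_props {ρ ρ' : ℝ} (hρρ' : ρ < ρ') (j : ℕ) :
    ρ < ρ + (ρ' - ρ) / 2 ^ j ∧ ρ + (ρ' - ρ) / 2 ^ j ≤ ρ' ∧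
      (ρ + (ρ' - ρ) / 2 ^ j) - (ρ + (ρ' - ρ) / 2 ^ (j + 1)) = (ρ' - ρ) / 2 ^ (j + 1) := by
  have h2j : (1 : ℝ) ≤ 2 ^ j := one_le_pow₀ (by norm_num)
  have hpos : (0 : ℝ) < 2 ^ j := by positivity
  refine ⟨by have := div_pos (sub_pos.2 hρρ') hpos; linarith, ?_, ?_⟩
  · have : (ρ' - ρ) / 2 ^ j ≤ ρ' - ρ := div_le_self (sub_pos.2 hρρ').le h2j
    linarith
  · rw [pow_succ]; field_simp; ring

/-- **Moser's chain on nested parabolic cylinders (memo R18 Appendix A.5 ⇒ A.6), generic.**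
Let `g` be a.e.-strongly measurable on `Q(z₁, ρ')`, `ρ'/2 ≤ ρ < ρ'`, `N₀ > 0`, and suppose the
reverse Hölder inequalities
`‖g‖_{L^{10m/3}(Q(z₁,ϱ))} ≤ (N₀ ϱ'/(ϱ'-ϱ)²)^{1/m} ‖g‖_{L^{2m}(Q(z₁,ϱ'))}`
hold for all `m ≥ 1` and `ρ ≤ ϱ < ϱ' ≤ ρ'`.  Then
`‖g‖_{L^∞(Q(z₁,ρ))} ≤ (16 N₀² ρ'²)^{5/4} · 16^{15/8} · (ρ'-ρ)^{-5} · ‖g‖_{L²(Q(z₁,ρ'))}`. -/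
theorem eLpNorm_top_le_of_reverseHolder_parabolicCylinder
    {g : ℝ × EuclideanSpace ℝ (Fin 3) → ℝ} {z₁ : ℝ × EuclideanSpace ℝ (Fin 3)} {ρ ρ' N₀ : ℝ}
    (hρ : ρ' / 2 ≤ ρ) (hρρ' : ρ < ρ') (hN₀ : 0 < N₀)
    (hg : AEStronglyMeasurable g (volume.restrict (parabolicCylinder ρ' z₁)))
    (H : ∀ m : ℝ, 1 ≤ m → ∀ ϱ ϱ' : ℝ, ρ ≤ ϱ → ϱ < ϱ' → ϱ' ≤ ρ' →
      eLpNorm g (ENNReal.ofReal (10 * m / 3)) (volume.restrict (parabolicCylinder ϱ z₁)) ≤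
        ENNReal.ofReal (N₀ * ϱ' / (ϱ' - ϱ) ^ 2) ^ (1 / m) *
          eLpNorm g (ENNReal.ofReal (2 * m)) (volume.restrict (parabolicCylinder ϱ' z₁))) :
    eLpNorm g ∞ (volume.restrict (parabolicCylinder ρ z₁)) ≤
      ENNReal.ofReal ((16 * N₀ ^ 2 * ρ' ^ 2) ^ (5 / 4 : ℝ) * 16 ^ (15 / 8 : ℝ) / (ρ' - ρ) ^ 5) *
        eLpNorm g 2 (volume.restrict (parabolicCylinder ρ' z₁)) := by
  have hρ0 : 0 < ρ := lt_of_lt_of_le (by linarith) hρ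
  have hρ'0 : 0 < ρ' := hρ0.trans hρρ'
  have hδ : 0 < ρ' - ρ := sub_pos.2 hρρ'
  -- the radii and the sets
  set μr : ℕ → ℝ := fun j => ρ + (ρ' - ρ) / 2 ^ j with hμr
  set A : ℕ → Set (ℝ × EuclideanSpace ℝ (Fin 3)) := fun j => parabolicCylinder (μr j) z₁ with hA
  set ν : Measure (ℝ × EuclideanSpace ℝ (Fin 3)) := volume.restrict (parabolicCylinder ρ' z₁) with hν
  have hμr0 : μr 0 = ρ' := by simp [hμr]
  have hAsub : ∀ j, A j ⊆ parabolicCylinder ρ' z₁ := fun j =>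
    parabolicCylinder_subset_of_le (hρ0.trans (moserRadius_props hρρ' j).1).le
      (moserRadius_props hρρ' j).2.1 z₁
  have hνA : ∀ j, ν.restrict (A j) = volume.restrict (A j) := by
    intro j
    rw [hν, Measure.restrict_restrict (isOpen_parabolicCylinder _ _).measurableSet,
      inter_eq_left.2 (hAsub j)]
  -- the constants
  set C₀r : ℝ := 16 * N₀ ^ 2 * ρ' ^ 2 / (ρ' - ρ) ^ 4 with hC₀r
  have hC₀r_pos : 0 < C₀r := by positivity
  set C₀ : ℝ≥0 := C₀r.toNNReal with hC₀
  have hC₀ne : C₀ ≠ 0 := by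
    rw [hC₀]; exact (Real.toNNReal_pos.2 hC₀r_pos).ne'
  have hC₀coe : (C₀ : ℝ≥0∞) = ENNReal.ofReal C₀r := rfl
  have hb : (16 : ℝ≥0) ≠ 0 := by norm_num
  -- ### the chain hypothesis
  have hchain : ∀ k : ℕ, eLpNorm g (ENNReal.ofReal (2 * (5 / 3 : ℝ) ^ (k + 1))) (ν.restrict (A (k + 1))) ≤
      ((C₀ : ℝ≥0∞) * ((16 : ℝ≥0) : ℝ≥0∞) ^ k) ^ (1 / (2 * (5 / 3 : ℝ) ^ k)) *
        eLpNorm g (ENNReal.ofReal (2 * (5 / 3 : ℝ) ^ k)) (ν.restrict (A k)) := by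
    intro k
    obtain ⟨hk1, hk2, hkd⟩ := moserRadius_props hρρ' k
    obtain ⟨hk1', hk2', -⟩ := moserRadius_props hρρ' (k + 1)
    have hm : (1 : ℝ) ≤ (5 / 3 : ℝ) ^ k := one_le_pow₀ (by norm_num)
    have hm0 : (0 : ℝ) < (5 / 3 : ℝ) ^ k := by positivity
    have hlt : μr (k + 1) < μr k := by
      have : (0 : ℝ) < (ρ' - ρ) / 2 ^ (k + 1) := by positivity
      linarith [hkd]
    have hH := H ((5 / 3 : ℝ) ^ k) hm (μr (k + 1)) (μr k) hk1'.le hlt hk2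
    rw [hνA, hνA]
    have e1 : ENNReal.ofReal (10 * (5 / 3 : ℝ) ^ k / 3) = ENNReal.ofReal (2 * (5 / 3 : ℝ) ^ (k + 1)) := by
      congr 1; rw [pow_succ]; ring
    rw [e1] at hH
    refine hH.trans (mul_le_mul' ?_ le_rfl)
    -- the constant: `(N₀ μ_k/(μ_k-μ_{k+1})²)^{1/m} ≤ (C₀ 16^k)^{1/(2m)}`
    have hX : ENNReal.ofReal (N₀ * μr k / (μr k - μr (k + 1)) ^ 2) ^ (1 / (5 / 3 : ℝ) ^ k) =
        (ENNReal.ofReal (N₀ * μr k / (μr k - μr (k + 1)) ^ 2) ^ (2 : ℝ)) ^ (1 / (2 * (5 / 3 : ℝ) ^ k)) := by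
      rw [← ENNReal.rpow_mul]; congr 1; field_simp
    rw [hX]
    refine ENNReal.rpow_le_rpow ?_ (by positivity)
    rw [ENNReal.ofReal_rpow_of_nonneg (by positivity) (by norm_num), hC₀coe,
      show ((16 : ℝ≥0) : ℝ≥0∞) = ENNReal.ofReal 16 by norm_num, ← ENNReal.ofReal_pow (by norm_num),
      ← ENNReal.ofReal_mul hC₀r_pos.le]
    refine ENNReal.ofReal_le_ofReal ?_
    have hμk : 0 < μr k := hρ0.trans hk1
    have hμk' : μr k ≤ ρ' := hk2
    have h2k : ((2 : ℝ) ^ (k + 1)) ^ 4 = 16 * 16 ^ k := by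
      rw [← pow_mul, mul_comm, pow_mul, pow_succ]; norm_num; ring
    have eX : (N₀ * μr k / (μr k - μr (k + 1)) ^ 2) ^ (2 : ℝ) =
        N₀ ^ 2 * μr k ^ 2 * (16 * 16 ^ k) / (ρ' - ρ) ^ 4 := by
      rw [Real.rpow_two, hkd]
      have h2 : (0 : ℝ) < 2 ^ (k + 1) := by positivity
      field_simp
      rw [← h2k]
    rw [eX, hC₀r]
    rw [show 16 * N₀ ^ 2 * ρ' ^ 2 / (ρ' - ρ) ^ 4 * 16 ^ k =
      N₀ ^ 2 * ρ' ^ 2 * (16 * 16 ^ k) / (ρ' - ρ) ^ 4 by ring]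
    gcongr
  -- ### the abstract iteration
  have hgν : AEStronglyMeasurable g ν := hg
  have key := eLpNorm_top_le_of_moser_chain (μ := ν) hgν (A := A) (p₀ := 2) (χ := 5 / 3)
    (by norm_num) (by norm_num) hC₀ne hb hchain
  -- ### reading off the conclusion
  have hsubI : parabolicCylinder ρ z₁ ⊆ ⋂ k, A k := subset_iInter fun k =>
    parabolicCylinder_subset_of_le hρ0.le (moserRadius_props hρρ' k).1.le z₁
  have hle : volume.restrict (parabolicCylinder ρ z₁) ≤ ν.restrict (⋂ k, A k) := by
    rw [hν, Measure.restrict_restrict (MeasurableSet.iInter fun k =>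
      (isOpen_parabolicCylinder _ _).measurableSet)]
    exact Measure.restrict_mono
      (subset_inter hsubI (hsubI.trans ((iInter_subset _ 0).trans (hAsub 0)))) le_rfl
  have h0 : ν.restrict (A 0) = volume.restrict (parabolicCylinder ρ' z₁) := by
    rw [hνA 0, hA]; simp only [hμr0]
  have e2 : ENNReal.ofReal (2 : ℝ) = 2 := by norm_num
  rw [h0, e2] at key
  refine (eLpNorm_mono_measure g hle).trans (key.trans (mul_le_mul' (le_of_eq ?_) le_rfl))
  -- the constant
  have eχ1 : (5 / 3 : ℝ) / (2 * (5 / 3 - 1)) = 5 / 4 := by norm_num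
  have eχ2 : (5 / 3 : ℝ) / (2 * (5 / 3 - 1) ^ 2) = 15 / 8 := by norm_num
  rw [eχ1, eχ2, hC₀coe, show ((16 : ℝ≥0) : ℝ≥0∞) = ENNReal.ofReal 16 by norm_num,
    ENNReal.ofReal_rpow_of_nonneg hC₀r_pos.le (by norm_num),
    ENNReal.ofReal_rpow_of_nonneg (by norm_num) (by norm_num), ← ENNReal.ofReal_mul (by positivity)]
  congr 1
  rw [hC₀r, Real.div_rpow (by positivity) (by positivity)]
  have e4 : ((ρ' - ρ) ^ 4) ^ (5 / 4 : ℝ) = (ρ' - ρ) ^ 5 := by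
    rw [show (ρ' - ρ) ^ 4 = (ρ' - ρ) ^ (4 : ℝ) by exact_mod_cast (Real.rpow_natCast _ 4).symm,
      ← Real.rpow_mul hδ.le, show (4 : ℝ) * (5 / 4) = (5 : ℕ) by norm_num, Real.rpow_natCast]
  rw [e4]
  ring

end

end Summit.NavierStokesRegularity.NavierStokesRegularity.Theorems.SwirlFreeBudget
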